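import Mathlib
import HarnessLib

/-!
# Route `PoloidalWindowDoor`, item `LrcModEntire` (stmt-NavierStokesRegularity-20428) — Morse branch of the thick residue (LINE 5 `thread_axis`, stub S7′-M):
# STRICT RADIAL MONOTONICITY NEAR A POINT WITH UNIFORMLY NEGATIVE HESSIAN

LEAD of item 20428 ns-poloidal-K2-p3 g10 (`--supports stmt-NavierStokesRegularity-20428 --as helper`).  First brick of the «parametrised Morse package»
S7′-M of `Cruxes/PoloidalWindowRigidity/Lines/thread_axis.lean` (the MORSE branch of the v5 thick residue S3, DIRECTOR-NS #217) along the route recorded in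
CENSUS-20428-g10 §7: no Morse lemma — near a critical point with uniformly negative second derivative along every line, the function is STRICTLY
RADIALLY DECREASING, so its near-top level sets are radial graphs.  Pure calculus on `EuclideanSpace ℝ (Fin 3)`:

* `hasDerivAt_fderiv_line` — `d/dt (Dg(x₀ + t•w) w) = D²g(x₀ + t•w)[w,w]`;
* `fderiv_apply_self_neg_of_hessian_neg` — if `Dg(x₀) = 0` and `D²g(y)[w,w] < 0` for all `y ∈ B(x₀,r)`, `w ≠ 0`, then for `y ∈ B(x₀,r)∖{x₀}`:
  `Dg(y)(y − x₀) < 0` (the radial derivative is negative);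
* `lt_of_hessian_neg` — and `g y < g x₀` (strict maximum on the punctured ball).

WHAT THIS IS NOT: not a claim about Navier–Stokes regularity and not S7′-M — a calculus brick (bears_on LADDER-NS N0). [folklore]
-/

noncomputable section

-- the summit and its single sub-problem share the name (CONVENTIONS §1), as in every Theorems file
set_option linter.dupNamespace false

namespace Summit.NavierStokesRegularity.NavierStokesRegularity.Theorems.PoloidalWindowDoorLrcModEntireRadialMax

open Set Filter Topology Metric

/-- Along the line `t ↦ x₀ + t•w`, the derivative of `t ↦ Dg(x₀ + t•w) w` is the second derivative `D²g(x₀ + t•w)[w,w]`. [folklore] -/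
theorem hasDerivAt_fderiv_line {g : (EuclideanSpace ℝ (Fin 3)) → ℝ} (hg : ContDiff ℝ 2 g) (x₀ w : (EuclideanSpace ℝ (Fin 3))) (t : ℝ) :
    HasDerivAt (fun s : ℝ => fderiv ℝ g (x₀ + s • w) w) (iteratedFDeriv ℝ 2 g (x₀ + t • w) ![w, w]) t := by
  have hd2 : Differentiable ℝ (fderiv ℝ g) := (hg.fderiv_right (m := 1) (by norm_num)).differentiable one_ne_zero
  have hline : HasDerivAt (fun s : ℝ => x₀ + s • w) w t := by
    simpa using ((hasDerivAt_id t).smul_const w).const_add x₀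
  have hc : HasDerivAt (fun s : ℝ => fderiv ℝ g (x₀ + s • w)) (fderiv ℝ (fderiv ℝ g) (x₀ + t • w) w) t :=
    (hd2 (x₀ + t • w)).hasFDerivAt.comp_hasDerivAt t hline
  have h2 := hc.clm_apply (hasDerivAt_const t w)
  rw [iteratedFDeriv_two_apply]
  simpa using h2

/-- Along the line, the derivative of `t ↦ g(x₀ + t•w)` is `Dg(x₀ + t•w) w`. [folklore] -/
theorem hasDerivAt_line {g : (EuclideanSpace ℝ (Fin 3)) → ℝ} (hg : ContDiff ℝ 2 g) (x₀ w : (EuclideanSpace ℝ (Fin 3))) (t : ℝ) :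
    HasDerivAt (fun s : ℝ => g (x₀ + s • w)) (fderiv ℝ g (x₀ + t • w) w) t := by
  have hd : Differentiable ℝ g := hg.differentiable (by norm_num)
  have hline : HasDerivAt (fun s : ℝ => x₀ + s • w) w t := by
    simpa using ((hasDerivAt_id t).smul_const w).const_add x₀
  exact (hd (x₀ + t • w)).hasFDerivAt.comp_hasDerivAt t hline

/-- **Negative radial derivative near a critical point with negative Hessian.**  If `Dg(x₀) = 0` and `D²g(y)[w,w] < 0` for every `y` in the
ball `B(x₀, r)` and every `w ≠ 0`, then `Dg(y)(y − x₀) < 0` for every `y ∈ B(x₀,r)`, `y ≠ x₀`. [folklore] -/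
theorem fderiv_apply_self_neg_of_hessian_neg {g : (EuclideanSpace ℝ (Fin 3)) → ℝ} (hg : ContDiff ℝ 2 g) {x₀ : (EuclideanSpace ℝ (Fin 3))} {r : ℝ}
    (h0 : fderiv ℝ g x₀ = 0) (hH : ∀ y ∈ ball x₀ r, ∀ w : (EuclideanSpace ℝ (Fin 3)), w ≠ 0 → iteratedFDeriv ℝ 2 g y ![w, w] < 0)
    {y : (EuclideanSpace ℝ (Fin 3))} (hy : y ∈ ball x₀ r) (hne : y ≠ x₀) : fderiv ℝ g y (y - x₀) < 0 := by
  set w : (EuclideanSpace ℝ (Fin 3)) := y - x₀ with hw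
  have hw0 : w ≠ 0 := sub_ne_zero.2 hne
  -- φ(s) := Dg(x₀ + s•w) w has φ(0) = 0 and φ' < 0 on [0,1]
  set φ : ℝ → ℝ := fun s => fderiv ℝ g (x₀ + s • w) w with hφ
  have hφ0 : φ 0 = 0 := by simp [hφ, h0]
  have hφ1 : φ 1 = fderiv ℝ g y w := by simp [hφ, hw]
  have hseg : ∀ s ∈ Icc (0 : ℝ) 1, x₀ + s • w ∈ ball x₀ r := by
    intro s hs
    rw [mem_ball, dist_eq_norm, add_sub_cancel_left, norm_smul, Real.norm_of_nonneg hs.1]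
    have hyr : ‖w‖ < r := by rwa [mem_ball, dist_eq_norm] at hy
    calc s * ‖w‖ ≤ 1 * ‖w‖ := mul_le_mul_of_nonneg_right hs.2 (norm_nonneg _)
      _ = ‖w‖ := one_mul _
      _ < r := hyr
  have hderiv : ∀ s, HasDerivAt φ (iteratedFDeriv ℝ 2 g (x₀ + s • w) ![w, w]) s := fun s =>
    hasDerivAt_fderiv_line hg x₀ w s
  have hanti : StrictAntiOn φ (Icc (0 : ℝ) 1) := by
    refine strictAntiOn_of_deriv_neg (convex_Icc 0 1) (fun s hs => (hderiv s).continuousAt.continuousWithinAt) ?_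
    intro s hs
    rw [interior_Icc] at hs
    rw [(hderiv s).deriv]
    exact hH _ (hseg s ⟨hs.1.le, hs.2.le⟩) w hw0
  have hlt : φ 1 < φ 0 := hanti (left_mem_Icc.2 zero_le_one) (right_mem_Icc.2 zero_le_one) zero_lt_one
  rw [hφ1, hφ0] at hlt
  simpa [hw] using hlt

/-- **Strict maximum on the punctured ball** under the same hypotheses: `g y < g x₀` for `y ∈ B(x₀,r)`, `y ≠ x₀`. [folklore] -/
theorem lt_of_hessian_neg {g : (EuclideanSpace ℝ (Fin 3)) → ℝ} (hg : ContDiff ℝ 2 g) {x₀ : (EuclideanSpace ℝ (Fin 3))} {r : ℝ}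
    (h0 : fderiv ℝ g x₀ = 0) (hH : ∀ y ∈ ball x₀ r, ∀ w : (EuclideanSpace ℝ (Fin 3)), w ≠ 0 → iteratedFDeriv ℝ 2 g y ![w, w] < 0)
    {y : (EuclideanSpace ℝ (Fin 3))} (hy : y ∈ ball x₀ r) (hne : y ≠ x₀) : g y < g x₀ := by
  set w : (EuclideanSpace ℝ (Fin 3)) := y - x₀ with hw
  have hw0 : w ≠ 0 := sub_ne_zero.2 hne
  -- ψ(s) := g(x₀ + s•w); ψ'(s) = Dg(x₀+s•w) w = (1/s)·Dg(z)(z − x₀) < 0 for s ∈ (0,1]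
  set ψ : ℝ → ℝ := fun s => g (x₀ + s • w) with hψ
  have hψ0 : ψ 0 = g x₀ := by simp [hψ]
  have hψ1 : ψ 1 = g y := by simp [hψ, hw]
  have hyr : ‖w‖ < r := by rwa [mem_ball, dist_eq_norm] at hy
  have hseg : ∀ s ∈ Ioc (0 : ℝ) 1, x₀ + s • w ∈ ball x₀ r ∧ x₀ + s • w ≠ x₀ := by
    intro s hs
    refine ⟨?_, ?_⟩
    · rw [mem_ball, dist_eq_norm, add_sub_cancel_left, norm_smul, Real.norm_of_nonneg hs.1.le]
      calc s * ‖w‖ ≤ 1 * ‖w‖ := mul_le_mul_of_nonneg_right hs.2 (norm_nonneg _)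
        _ = ‖w‖ := one_mul _
        _ < r := hyr
    · intro h
      have : s • w = 0 := by simpa using h
      rcases smul_eq_zero.1 this with h1 | h1
      · exact hs.1.ne' h1
      · exact hw0 h1
  have hderiv : ∀ s, HasDerivAt ψ (fderiv ℝ g (x₀ + s • w) w) s := fun s => hasDerivAt_line hg x₀ w s
  have hanti : StrictAntiOn ψ (Icc (0 : ℝ) 1) := by
    refine strictAntiOn_of_deriv_neg (convex_Icc 0 1) (fun s hs => (hderiv s).continuousAt.continuousWithinAt) ?_
    intro s hs
    rw [interior_Icc] at hs
    rw [(hderiv s).deriv]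
    obtain ⟨hzB, hzne⟩ := hseg s ⟨hs.1, hs.2.le⟩
    have hrad := fderiv_apply_self_neg_of_hessian_neg hg h0 hH hzB hzne
    -- `Dg(z)(z − x₀) = s · Dg(z) w` with `s > 0`
    have e : (x₀ + s • w) - x₀ = s • w := add_sub_cancel_left _ _
    rw [e, map_smul, smul_eq_mul] at hrad
    exact (pos_iff_neg_of_mul_neg hrad).mp hs.1 |> fun h => by linarith [h] 
  have hlt : ψ 1 < ψ 0 := hanti (left_mem_Icc.2 zero_le_one) (right_mem_Icc.2 zero_le_one) zero_lt_one
  rw [hψ1, hψ0] at hlt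
  exact hlt

/-! ### Appended (LEAD g10, 13:00Z): definiteness at the point ⇒ uniform negativity on a ball (finite dimension), and the local strict-maximum corollary -/

/-- Homogeneity of the Hessian quadratic form: `D²g(y)[t•w, t•w] = t² · D²g(y)[w,w]`. [folklore] -/
theorem hessian_quad_smul (g : (EuclideanSpace ℝ (Fin 3)) → ℝ) (y w : EuclideanSpace ℝ (Fin 3)) (t : ℝ) :
    iteratedFDeriv ℝ 2 g y ![t • w, t • w] = t ^ 2 * iteratedFDeriv ℝ 2 g y ![w, w] := by
  rw [iteratedFDeriv_two_apply, iteratedFDeriv_two_apply]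
  simp only [Matrix.cons_val_zero, Matrix.cons_val_one, map_smul, FunLike.coe_smul, Pi.smul_apply,
    smul_eq_mul]
  ring

/-- The Hessian quadratic form is Lipschitz in the base point through the operator norm:
`|D²g(y)[w,w] − D²g(x₀)[w,w]| ≤ ‖D²g(y) − D²g(x₀)‖ · ‖w‖²`. [folklore] -/
theorem abs_hessian_quad_sub_le (g : (EuclideanSpace ℝ (Fin 3)) → ℝ) (y x₀ w : EuclideanSpace ℝ (Fin 3)) :
    |iteratedFDeriv ℝ 2 g y ![w, w] - iteratedFDeriv ℝ 2 g x₀ ![w, w]| ≤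
      ‖iteratedFDeriv ℝ 2 g y - iteratedFDeriv ℝ 2 g x₀‖ * ‖w‖ ^ 2 := by
  have h := (iteratedFDeriv ℝ 2 g y - iteratedFDeriv ℝ 2 g x₀).le_opNorm ![w, w]
  simp only [sub_apply, Fin.prod_univ_two, Matrix.cons_val_zero,
    Matrix.cons_val_one, Real.norm_eq_abs] at h
  simpa [sq] using h

/-- **Definite at the point ⇒ uniformly negative on a ball.**  If `g` is `C²` and `D²g(x₀)[w,w] < 0` for every `w ≠ 0`, then there is `r > 0` with
`D²g(y)[w,w] < 0` for all `y ∈ B(x₀,r)` and all `w ≠ 0` (compact unit sphere + continuity of `y ↦ D²g(y)` in operator norm). [folklore] -/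
theorem exists_ball_hessian_neg {g : (EuclideanSpace ℝ (Fin 3)) → ℝ} (hg : ContDiff ℝ 2 g) {x₀ : EuclideanSpace ℝ (Fin 3)}
    (hneg : ∀ w : EuclideanSpace ℝ (Fin 3), w ≠ 0 → iteratedFDeriv ℝ 2 g x₀ ![w, w] < 0) :
    ∃ r > 0, ∀ y ∈ ball x₀ r, ∀ w : EuclideanSpace ℝ (Fin 3), w ≠ 0 → iteratedFDeriv ℝ 2 g y ![w, w] < 0 := by
  set Q : EuclideanSpace ℝ (Fin 3) → ℝ := fun w => iteratedFDeriv ℝ 2 g x₀ ![w, w] with hQ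
  -- `Q` is continuous
  have hQc : Continuous Q := by
    have hQ' : Q = fun w => (fderiv ℝ (fderiv ℝ g) x₀ w) w := by
      funext w; simp only [hQ, iteratedFDeriv_two_apply, Matrix.cons_val_zero, Matrix.cons_val_one]
    rw [hQ']
    exact (fderiv ℝ (fderiv ℝ g) x₀).continuous₂.comp (continuous_id.prodMk continuous_id)
  -- maximum of `Q` on the (compact, nonempty) unit sphere is negative
  have hS : IsCompact (sphere (0 : EuclideanSpace ℝ (Fin 3)) 1) := isCompact_sphere _ _
  have hSne : (sphere (0 : EuclideanSpace ℝ (Fin 3)) 1).Nonempty :=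
    ⟨EuclideanSpace.single 0 1, by simp⟩
  obtain ⟨w₀, hw₀S, hw₀max⟩ := hS.exists_isMaxOn hSne hQc.continuousOn
  have hw₀ne : w₀ ≠ 0 := by
    intro h; rw [h, mem_sphere_zero_iff_norm, norm_zero] at hw₀S; exact zero_ne_one hw₀S
  set c : ℝ := -Q w₀ with hc
  have hcpos : 0 < c := by simp only [hc, hQ]; linarith [hneg w₀ hw₀ne]
  have hQle : ∀ w : EuclideanSpace ℝ (Fin 3), Q w ≤ -c * ‖w‖ ^ 2 := by
    intro w
    by_cases hw : w = 0
    · subst hw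
      have : Q 0 = 0 := by
        have h := hessian_quad_smul g x₀ (0 : EuclideanSpace ℝ (Fin 3)) 0
        simp only [zero_smul, hQ] at h ⊢
        simpa using h
      rw [this]; simp
    · have hn : 0 < ‖w‖ := norm_pos_iff.2 hw
      have hu : (‖w‖⁻¹ • w) ∈ sphere (0 : EuclideanSpace ℝ (Fin 3)) 1 := by
        rw [mem_sphere_zero_iff_norm, norm_smul, norm_inv, norm_norm, inv_mul_cancel₀ hn.ne']
      have hmax : Q (‖w‖⁻¹ • w) ≤ Q w₀ := hw₀max hu
      have hhom : Q (‖w‖⁻¹ • w) = ‖w‖⁻¹ ^ 2 * Q w := hessian_quad_smul g x₀ w ‖w‖⁻¹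
      rw [hhom] at hmax
      have hw2 : 0 < ‖w‖ ^ 2 := by positivity
      have : Q w = ‖w‖ ^ 2 * (‖w‖⁻¹ ^ 2 * Q w) := by field_simp
      rw [this]
      nlinarith [hmax]
  -- continuity of `y ↦ D²g(y)` at `x₀` in operator norm
  have hcont : Continuous fun y => iteratedFDeriv ℝ 2 g y := hg.continuous_iteratedFDeriv (le_refl _)
  obtain ⟨r, hr, hball⟩ := Metric.continuousAt_iff.1 (hcont.continuousAt (x := x₀)) (c / 2) (by positivity)
  refine ⟨r, hr, fun y hy w hw => ?_⟩
  have hdist : ‖iteratedFDeriv ℝ 2 g y - iteratedFDeriv ℝ 2 g x₀‖ < c / 2 := by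
    have h := hball hy
    rwa [dist_eq_norm] at h
  have hlip := abs_hessian_quad_sub_le g y x₀ w
  have hw2 : 0 < ‖w‖ ^ 2 := by have hn : 0 < ‖w‖ := norm_pos_iff.2 hw; positivity
  have h1 : iteratedFDeriv ℝ 2 g y ![w, w] ≤ Q w + ‖iteratedFDeriv ℝ 2 g y - iteratedFDeriv ℝ 2 g x₀‖ * ‖w‖ ^ 2 := by
    have := (abs_le.1 hlip).2; simp only [hQ]; linarith
  have h2 : ‖iteratedFDeriv ℝ 2 g y - iteratedFDeriv ℝ 2 g x₀‖ * ‖w‖ ^ 2 ≤ c / 2 * ‖w‖ ^ 2 :=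
    mul_le_mul_of_nonneg_right hdist.le hw2.le
  nlinarith [hQle w, h1, h2]

/-- **LOCAL STRICT MAXIMUM at a critical point with negative definite Hessian** (the two bricks combined): `∃ r > 0`, on the punctured
ball `B(x₀,r)∖{x₀}` the radial derivative `Dg(y)(y − x₀)` is negative and `g y < g x₀`. [folklore] -/
theorem exists_ball_strictMax_of_hessian_neg {g : (EuclideanSpace ℝ (Fin 3)) → ℝ} (hg : ContDiff ℝ 2 g) {x₀ : EuclideanSpace ℝ (Fin 3)}
    (h0 : fderiv ℝ g x₀ = 0) (hneg : ∀ w : EuclideanSpace ℝ (Fin 3), w ≠ 0 → iteratedFDeriv ℝ 2 g x₀ ![w, w] < 0) :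
    ∃ r > 0, ∀ y ∈ ball x₀ r, y ≠ x₀ → fderiv ℝ g y (y - x₀) < 0 ∧ g y < g x₀ := by
  obtain ⟨r, hr, hH⟩ := exists_ball_hessian_neg hg hneg
  exact ⟨r, hr, fun y hy hne => ⟨fderiv_apply_self_neg_of_hessian_neg hg h0 hH hy hne, lt_of_hessian_neg hg h0 hH hy hne⟩⟩

end Summit.NavierStokesRegularity.NavierStokesRegularity.Theorems.PoloidalWindowDoorLrcModEntireRadialMax
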